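import Summits.Langlands.Langlands.Theorems.IrreducibilityBySelfDualityReciprocityUpToIrreducibilityAwayUnramified
import HarnessLib

/-!
# Line `Sketch` for the crux `ReciprocityUpToIrreducibility` (item stmt-Langlands-14328), continuation c7:
# `(ρ|_{W_F}, 0)` is attached to `ρ` by the Grothendieck–Deligne recipe on the FINITE-INERTIA sector

Support file (closes nothing; continuation lead c7, stub S-A of wave N7).

Statement (`stub_isWeilDeligneOfLadic_ofRep_of_isContinuousRep`): for a framed representation
`ρ : Γ_F → GL_n(E)` of the absolute Galois group of a non-archimedean local field `F` whose
restriction `ρ|_{W_F}` is continuous for the discrete topology (`WeilGroup.IsContinuousRep`: trivial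
on some open subgroup `U ≤ I_F`), granted for every open subgroup `U` of `W_F` a character
`t : I_F →* Multiplicative E` non-trivial at some `u ∈ U`, the Weil–Deligne representation
`(ρ|_{W_F}, N = 0)` = `WeilDeligneRep.ofRep (ρ.weilRestrict F) hc` is attached to `ρ.toWeilGroupHom`
by `IsWeilDeligneOfLadic` — the finite-inertia generalisation of c4's unramified
`isWeilDeligneOfLadic_ofRep_weilRestrict`.

Proof: take the open `U ≤ I_F` killed by `ρ|_{W_F}` (from `hc`), the granted `t` non-trivial on `U`,
a geometric Frobenius `Φ` (`WeilGroup.deg_surjective`), and apply `IsWeilDeligneOfLadic.of_N_eq_zero`: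
`ρ.toWeilGroupHom u = 1` on `U` because its matrix is that of `ρ|_{W_F}(u) = 1`
(`toMatrix'_weilRestrict`, `LinearMap.toMatrix'_one`, `Units.val_eq_one`), and the matrices of
`(ρ|_{W_F}, 0)` are those of `ρ.toWeilGroupHom` (`WeilDeligneRep.ofRep_ρ`, `toMatrix'_weilRestrict`).
No definitions; std axioms; no named fact assumed.
-/

noncomputable section

set_option linter.dupNamespace false -- project-wide option (lakefile weak.linter.dupNamespace); `Summit.Langlands.Langlands` is the mandated namespace

open scoped MatrixGroups Matrix NumberField Classical
open Filter IsDedekindDomain Field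
open Literature.NumberTheory.Automorphic Literature.NumberTheory.GaloisRepresentations
open Literature.NumberTheory.PAdicHodge
open Summit.Langlands

namespace Summit.Langlands.Langlands.Theorems.ReciprocityUpToIrreducibility

section Local

variable {F : Type} [Field F] [ValuativeRel F] [TopologicalSpace F] [IsNonarchimedeanLocalField F]
  {A : Type*} [CommRing A] [TopologicalSpace A] {n : ℕ}

/-- `ρ.toWeilGroupHom w = 1` as soon as `ρ|_{W_F}(w) = 1` as an endomorphism of `Fin n → A`: both have
the same matrix in the standard basis (`toMatrix'_weilRestrict`). [folklore] -/
theorem toWeilGroupHom_eq_one_of_weilRestrict_eq_one (ρ : FramedRep (absoluteGaloisGroup F) A n)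
    {w : WeilGroup F} (hw : ρ.weilRestrict F w = 1) : ρ.toWeilGroupHom w = 1 := by
  rw [← Units.val_eq_one, ← toMatrix'_weilRestrict ρ w, hw, LinearMap.toMatrix'_one]

variable {E : Type*} [Field E] [CharZero E] [TopologicalSpace E]

/-- **`(ρ|_{W_F}, 0)` is attached to `ρ` by the Grothendieck–Deligne recipe on the finite-inertia
sector.**  If `ρ|_{W_F}` is continuous for the discrete topology (trivial on an open subgroup
`U ≤ I_F`) and every open subgroup of `W_F` carries a character `t : I_F →* Multiplicative E`
non-trivial at one of its elements, then `IsWeilDeligneOfLadic ρ.toWeilGroupHom (ρ|_{W_F}, 0)`: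
take that `U`, such a `t`, a geometric Frobenius `Φ` (`deg` is surjective) and `N = 0`
(`IsWeilDeligneOfLadic.of_N_eq_zero`). [cite: TateCorvallis1979, (4.1.3)–(4.2.1)]
[cite: DeligneAntwerpII1973, §8.4.2] -/
theorem isWeilDeligneOfLadic_ofRep_of_isContinuousRep (ρ : FramedRep (absoluteGaloisGroup F) E n)
    (hc : WeilGroup.IsContinuousRep (ρ.weilRestrict F))
    (ht : ∀ U : Subgroup (WeilGroup F), IsOpen (U : Set (WeilGroup F)) →
      ∃ t : WeilGroup.inertia F →* Multiplicative E, ∃ u : WeilGroup.inertia F,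
        (u : WeilGroup F) ∈ U ∧ t u ≠ 1) :
    IsWeilDeligneOfLadic ρ.toWeilGroupHom (WeilDeligneRep.ofRep (ρ.weilRestrict F) hc) := by
  obtain ⟨U, hU, hUo, hker⟩ := hc
  obtain ⟨t, u, huU, htu⟩ := ht U hUo
  obtain ⟨Φ, hΦ⟩ := WeilGroup.deg_surjective IsFrobPow.mul_holds IsFrobPow.unique_holds
    (exists_isFrobPow_holds F) (-1 : ℤ)
  refine IsWeilDeligneOfLadic.of_N_eq_zero ρ.toWeilGroupHom _ (WeilDeligneRep.ofRep_N _ _) t U hU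
    hUo ⟨u, huU, htu⟩ (fun w hw => toWeilGroupHom_eq_one_of_weilRestrict_eq_one ρ (hker w hw)) Φ hΦ
    fun m w => ?_
  rw [WeilDeligneRep.ofRep_ρ, toMatrix'_weilRestrict]

end Local

/-- **Registered stub `stub_isWeilDeligneOfLadic_ofRep_of_isContinuousRep` of line `Sketch` (crux
stmt-Langlands-14328, c7 wave N7)**: closed form of `isWeilDeligneOfLadic_ofRep_of_isContinuousRep`.
For `ρ : Γ_F → GL_n(E)` with `ρ|_{W_F}` continuous for the discrete topology, granted on every open
subgroup of `W_F` a character of `I_F` with values in `Multiplicative E` non-trivial at one of its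
elements, the Weil–Deligne representation `(ρ|_{W_F}, N = 0)` is attached to `ρ.toWeilGroupHom` by
the Grothendieck–Deligne recipe `IsWeilDeligneOfLadic` (the open `U ≤ I_F` killed by `ρ|_{W_F}`, the
granted `t`, a geometric Frobenius from `WeilGroup.deg_surjective`, `IsWeilDeligneOfLadic.of_N_eq_zero`).
[cite: DeligneAntwerpII1973, §8.4.2] [cite: TateCorvallis1979, (4.1.3)–(4.2.1)] -/
theorem stub_isWeilDeligneOfLadic_ofRep_of_isContinuousRep :
    ∀ (F : Type) [Field F] [ValuativeRel F] [TopologicalSpace F] [IsNonarchimedeanLocalField F]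
      (E : Type) [Field E] [CharZero E] [TopologicalSpace E] (n : ℕ)
      (ρ : FramedRep (Field.absoluteGaloisGroup F) E n) (hc : WeilGroup.IsContinuousRep (ρ.weilRestrict F)),
      (∀ U : Subgroup (WeilGroup F), IsOpen (U : Set (WeilGroup F)) →
        ∃ t : WeilGroup.inertia F →* Multiplicative E, ∃ u : WeilGroup.inertia F,
          (u : WeilGroup F) ∈ U ∧ t u ≠ 1) →
      IsWeilDeligneOfLadic ρ.toWeilGroupHom (WeilDeligneRep.ofRep (ρ.weilRestrict F) hc) :=
  fun _ _ _ _ _ _ _ _ _ _ ρ hc ht => isWeilDeligneOfLadic_ofRep_of_isContinuousRep ρ hc ht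

end Summit.Langlands.Langlands.Theorems.ReciprocityUpToIrreducibility

end
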